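import Mathlib
import Literature.AlgebraicGeometry.Tropical.TorusCycles
import Summits.HodgeConjecture.HodgeConjecture.Theorems.TropicalWeilObstructionTropicalWeilVanishingTransportCycles
import HarnessLib

/-!
# Crux `TropicalWeilVanishing` (stmt-HodgeConjecture-18478) — transport of effective tropical cycles along
# integral `ℤ[i]`-linear maps, with the Weil functional, the hermitian mass and calibration carried along

Route `TropicalWeilObstruction` of `HodgeConjecture` (Hodge NEGATION SINK `pub-hodge-tropical`; scoped exploration,
no summit claim; nothing here bears on the Hodge conjecture and nothing here decides K1).

`…TransportCycles` proves, on UNBUNDLED data, that the certificate format `TropicalTorusCycle` is stable under the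
isogeny transport `x ↦ F(s x)` (Mikhalkin–Zharkov Prop. 4.3, Zharkov §2). This file BUNDLES it and carries the
three numerical invariants of the crux along:

* `exists_transport` — for an effective tropical `n`-cycle `Z` on `ℝ²ⁿ/P·ℤ²ⁿ`, an integer `F` commuting with
  `J = weilJ n` with `det F ≠ 0`, a scale `s > 0` and a period `Q'` with `F · (sP) = Q' · K` (`K` integral), there is
  an effective tropical `n`-cycle `Z'` on `ℝ²ⁿ/Q'·ℤ²ⁿ` with the same number of cells, frames `L'_σ` with
  `F L_σ = L'_σ R_σ` (`det R_σ > 0`), `W(Z') = sⁿ · det_ℂ(F)² · W(Z)` and `μ(Z') = sⁿ · |det_ℂ F|² · μ(Z)`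
  (`μ(Z) = Σ_σ w_σ a_σ |η_σ|²` the hermitian mass): the PHASE `W/μ` is multiplied by `det_ℂ(F)/conj det_ℂ(F)`;
* `exists_endomorphism_transport` — the scalar isogenies `k = a·1 + b·J` (`(a,b) ≠ 0`) are endomorphisms of
  EVERY `X_Q` with `QJ = JQ` (`F = k`, `s = 1`, `K = k`, `Q' = Q`): `W ↦ (a + bi)^{2n} W`, `μ ↦ (a² + b²)ⁿ μ`;
* `collinear_transport` — calibration (all `η_σ` on one real line through `0`, `Re(ζ η_σ) = 0`) is carried to
  the transported frames with `ζ' = ζ · conj det_ℂ(F)`;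
* `sq_mul_weilFunctional_of_collinear` — for a collinear cycle `ζ² · W(Z) = −|ζ|² · μ(Z)` (the phase of a
  calibrated cycle is read off its frames; `ζ = 1`: `W = −μ`, the property of the n = 2 seed `CalibTwo.seed`),
  and conversely `W = −μ` forces `Re η_σ = 0` for every cell.

Mathlib + the tree's transport lemmas; no definition, no named fact, no sorry.

## References

* [MikhalkinZharkov2014Eigenwave] G. Mikhalkin, I. Zharkov, Tropical eigenwave and intermediate Jacobians,
  LN UMI 15 (2014), Def. 4.2, Prop. 4.3, Def. 6.1.
* [Zharkov2020TropicalWeil] I. Zharkov, Tropical abelian varieties, Weil classes and the Hodge conjecture,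
  arXiv:2002.02347 (2020), §2 (pp. 2–4).
-/

-- `Summit.HodgeConjecture.HodgeConjecture.…` is the mandated namespace (single-conjunct summit).
set_option linter.dupNamespace false

noncomputable section

open scoped BigOperators Matrix ComplexConjugate
open Matrix Literature.AlgebraicGeometry.Tropical

namespace Summit.HodgeConjecture.HodgeConjecture.Theorems.TropicalWeilVanishing.Phases

/-! ## §0 Display-only notation (nothing is defined) -/

/-- The hermitian mass `μ(Z) = Σ_σ w_σ a_σ |η_σ|²` of an effective tropical `n`-cycle (display-only). -/
local notation3 (prettyPrint := false) "μ⟦" n ", " Z "⟧" =>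
  (∑ σ, ((TropicalTorusCycle.cell Z σ).weight : ℝ) * (TropicalTorusCycle.cell Z σ).latticeVolume *
    ‖frameComplexDet n (TropicalTorusCycle.cell Z σ).frame‖ ^ 2)

/-- `det_ℂ(F)`: the complex determinant of an integral `J`-commuting `F = [[A, -C], [C, A]]`, i.e. `det(A + iC)`
(display-only; the expression of `…TransportCycles.transport_weilFunctional`). -/
local notation3 (prettyPrint := false) "detC⟦" n ", " F "⟧" =>
  (Matrix.det (Matrix.of fun k j : Fin n =>
    ((F ⟨(k : ℕ), Nat.lt_of_lt_of_le k.isLt (Nat.le_mul_of_pos_left n Nat.two_pos)⟩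
        ⟨(j : ℕ), Nat.lt_of_lt_of_le j.isLt (Nat.le_mul_of_pos_left n Nat.two_pos)⟩ : ℤ) : ℂ) +
      ((F ⟨(k : ℕ) + n, Nat.lt_of_lt_of_eq (Nat.add_lt_add_right k.isLt n) (two_mul n).symm⟩
        ⟨(j : ℕ), Nat.lt_of_lt_of_le j.isLt (Nat.le_mul_of_pos_left n Nat.two_pos)⟩ : ℤ) : ℂ) * Complex.I))

variable {n : ℕ}

/-! ## §1 The phase of a collinear (calibrated) cycle is read off its frames -/

/-- **`ζ² · W(Z) = −|ζ|² · μ(Z)` for a collinear cycle.** If `Re(ζ η_σ) = 0` for every cell then `ζη_σ = i t_σ`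
with `t_σ` real, so `ζ² η_σ² = −t_σ² = −|ζ|²|η_σ|²` term by term. (For `ζ ≠ 0` this says `W(Z) = −(conj ζ/ζ) μ(Z)`:
a collinear cycle is calibrated, `|W| = μ`, with phase determined by the frames alone.)
[cite: Zharkov2020TropicalWeil, §2 (pp. 2–4)] -/
theorem sq_mul_weilFunctional_of_collinear {Q : Matrix (Fin (2 * n)) (Fin (2 * n)) ℝ}
    (Z : TropicalTorusCycle (2 * n) n Q) (ζ : ℂ)
    (h : ∀ σ, (ζ * frameComplexDet n (Z.cell σ).frame).re = 0) :
    ζ ^ 2 * weilFunctional Z = -((‖ζ‖ ^ 2 * μ⟦n, Z⟧ : ℝ) : ℂ) := by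
  unfold weilFunctional
  rw [Finset.mul_sum, Finset.mul_sum, Complex.ofReal_sum, ← Finset.sum_neg_distrib]
  refine Finset.sum_congr rfl fun σ _ => ?_
  set η : ℂ := frameComplexDet n (Z.cell σ).frame with hη
  have hre : (ζ * η).re = 0 := h σ
  set t : ℝ := (ζ * η).im with ht
  have hz : ζ * η = ((t : ℝ) : ℂ) * Complex.I := by
    apply Complex.ext
    · rw [hre]; simp
    · simp [ht]
  have hsq : (ζ * η) ^ 2 = -(((t : ℝ) : ℂ) ^ 2) := by
    rw [hz, mul_pow, Complex.I_sq]; ring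
  have hnorm : ‖ζ‖ ^ 2 * ‖η‖ ^ 2 = t ^ 2 := by
    rw [← mul_pow, ← norm_mul, hz, norm_mul, Complex.norm_I, mul_one, Complex.norm_real, Real.norm_eq_abs,
      sq_abs]
  have e1 : ζ ^ 2 * (((Z.cell σ).weight : ℂ) * (((Z.cell σ).latticeVolume : ℝ) : ℂ) * η ^ 2) =
      ((Z.cell σ).weight : ℂ) * (((Z.cell σ).latticeVolume : ℝ) : ℂ) * (ζ * η) ^ 2 := by ring
  rw [e1, hsq]
  have e2 : (‖ζ‖ ^ 2 * (((Z.cell σ).weight : ℝ) * (Z.cell σ).latticeVolume * ‖η‖ ^ 2) : ℝ) =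
      ((Z.cell σ).weight : ℝ) * (Z.cell σ).latticeVolume * t ^ 2 := by
    rw [← hnorm]; ring
  rw [e2]
  push_cast
  ring

/-- **`W(Z) = −μ(Z)` when every cell has purely imaginary complex determinant** (`ζ = 1`; the property
`reEta = 0` of the tree's n = 2 seed `CalibTwo.seed`, here for any `n` and any period). [cite: Zharkov2020TropicalWeil, §2 (pp. 2–4)] -/
theorem weilFunctional_eq_neg_mass_of_re_eq_zero {Q : Matrix (Fin (2 * n)) (Fin (2 * n)) ℝ}
    (Z : TropicalTorusCycle (2 * n) n Q) (h : ∀ σ, (frameComplexDet n (Z.cell σ).frame).re = 0) :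
    weilFunctional Z = -((μ⟦n, Z⟧ : ℝ) : ℂ) := by
  have := sq_mul_weilFunctional_of_collinear Z 1 (fun σ => by simpa using h σ)
  simpa using this

/-- Conversely, **`W(Z) = −μ(Z)` forces every cell's complex determinant to be purely imaginary**: equality
`Re W = −μ` reads `Σ_σ w_σ a_σ ((Re η_σ)² − (Im η_σ)²) = −Σ_σ w_σ a_σ ((Re η_σ)² + (Im η_σ)²)`, i.e.
`Σ_σ 2 w_σ a_σ (Re η_σ)² = 0` with positive coefficients. [cite: Zharkov2020TropicalWeil, §2 (pp. 2–4)] -/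
theorem re_eq_zero_of_weilFunctional_eq_neg_mass {Q : Matrix (Fin (2 * n)) (Fin (2 * n)) ℝ}
    (Z : TropicalTorusCycle (2 * n) n Q) (h : weilFunctional Z = -((μ⟦n, Z⟧ : ℝ) : ℂ)) :
    ∀ σ, (frameComplexDet n (Z.cell σ).frame).re = 0 := by
  have hre := congrArg Complex.re h
  unfold weilFunctional at hre
  rw [Complex.re_sum, Complex.neg_re, Complex.ofReal_re] at hre
  -- `Σ w a (re² - im²) = - Σ w a (re² + im²)`
  have hterm : ∀ σ, (((Z.cell σ).weight : ℂ) * (((Z.cell σ).latticeVolume : ℝ) : ℂ) *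
      frameComplexDet n (Z.cell σ).frame ^ 2).re =
      ((Z.cell σ).weight : ℝ) * (Z.cell σ).latticeVolume *
        ((frameComplexDet n (Z.cell σ).frame).re ^ 2 - (frameComplexDet n (Z.cell σ).frame).im ^ 2) := by
    intro σ
    rw [show ((Z.cell σ).weight : ℂ) * (((Z.cell σ).latticeVolume : ℝ) : ℂ) * frameComplexDet n (Z.cell σ).frame ^ 2 =
        ((((Z.cell σ).weight : ℝ) * (Z.cell σ).latticeVolume : ℝ) : ℂ) * frameComplexDet n (Z.cell σ).frame ^ 2 by
      push_cast; ring, Complex.re_ofReal_mul, sq, Complex.mul_re]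
    ring
  have hnorm : ∀ σ, ‖frameComplexDet n (Z.cell σ).frame‖ ^ 2 =
      (frameComplexDet n (Z.cell σ).frame).re ^ 2 + (frameComplexDet n (Z.cell σ).frame).im ^ 2 := by
    intro σ
    rw [Complex.sq_norm, Complex.normSq_apply]; ring
  simp_rw [hterm, hnorm] at hre
  have hsum : ∑ σ, 2 * (((Z.cell σ).weight : ℝ) * (Z.cell σ).latticeVolume) *
      (frameComplexDet n (Z.cell σ).frame).re ^ 2 = 0 := by
    have : ∑ σ, (((Z.cell σ).weight : ℝ) * (Z.cell σ).latticeVolume *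
        ((frameComplexDet n (Z.cell σ).frame).re ^ 2 - (frameComplexDet n (Z.cell σ).frame).im ^ 2) +
        ((Z.cell σ).weight : ℝ) * (Z.cell σ).latticeVolume *
        ((frameComplexDet n (Z.cell σ).frame).re ^ 2 + (frameComplexDet n (Z.cell σ).frame).im ^ 2)) = 0 := by
      rw [Finset.sum_add_distrib, hre, neg_add_cancel]
    rw [← this]
    exact Finset.sum_congr rfl fun σ _ => by ring
  have hpos : ∀ σ, 0 < 2 * (((Z.cell σ).weight : ℝ) * (Z.cell σ).latticeVolume) := by
    intro σ
    refine mul_pos two_pos (mul_pos (by exact_mod_cast (Z.cell σ).weight_pos) ?_)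
    unfold TropicalCell.latticeVolume
    exact div_pos (Z.cell σ).edgeCoeff_det_pos (by exact_mod_cast Nat.factorial_pos n)
  have hnn : ∀ σ ∈ Finset.univ, 0 ≤ 2 * (((Z.cell σ).weight : ℝ) * (Z.cell σ).latticeVolume) *
      (frameComplexDet n (Z.cell σ).frame).re ^ 2 := fun σ _ => mul_nonneg (hpos σ).le (sq_nonneg _)
  intro σ
  have h0 := (Finset.sum_eq_zero_iff_of_nonneg hnn).1 hsum σ (Finset.mem_univ σ)
  rcases mul_eq_zero.1 h0 with h1 | h2
  · exact absurd h1 (hpos σ).ne'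
  · exact (pow_eq_zero_iff two_ne_zero).1 h2

/-! ## §2 Bundled transport along an integral `J`-commuting map -/

/-- `η(L') · det R = det_ℂ(F) · η(L)` when `F L = L' R` and `F` commutes with `J`. [cite: Zharkov2020TropicalWeil, §2 (pp. 2–4)] -/
theorem frameComplexDet_transport (F : Matrix (Fin (2 * n)) (Fin (2 * n)) ℤ)
    (hFJ : F.map ((↑) : ℤ → ℝ) * weilJ n = weilJ n * F.map ((↑) : ℤ → ℝ))
    (L L' : Matrix (Fin (2 * n)) (Fin n) ℤ) (R : Matrix (Fin n) (Fin n) ℤ) (hfac : F * L = L' * R) :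
    frameComplexDet n L' * (R.det : ℂ) = detC⟦n, F⟧ * frameComplexDet n L := by
  obtain ⟨hF1, hF2⟩ := blocks_of_commute_weilJ F hFJ
  rw [← frameComplexDet_mul_right, ← hfac, frameComplexDet_left_mul F hF1 hF2]

/-- **Calibration is carried along**: if `Re(ζ η_σ) = 0` for the source frames and `F L_σ = L'_σ R_σ`
(`det R_σ > 0`), then `Re(ζ · conj det_ℂ(F) · η'_σ) = 0` for the transported frames.
[cite: Zharkov2020TropicalWeil, §2 (pp. 2–4)] -/
theorem collinear_transport (F : Matrix (Fin (2 * n)) (Fin (2 * n)) ℤ)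
    (hFJ : F.map ((↑) : ℤ → ℝ) * weilJ n = weilJ n * F.map ((↑) : ℤ → ℝ))
    (L L' : Matrix (Fin (2 * n)) (Fin n) ℤ) (R : Matrix (Fin n) (Fin n) ℤ) (hfac : F * L = L' * R)
    (hR : 0 < R.det) (ζ : ℂ) (h : (ζ * frameComplexDet n L).re = 0) :
    (ζ * (starRingEnd ℂ) detC⟦n, F⟧ * frameComplexDet n L').re = 0 := by
  have key := frameComplexDet_transport F hFJ L L' R hfac
  set D : ℂ := detC⟦n, F⟧ with hD
  have hRne : (R.det : ℂ) ≠ 0 := by exact_mod_cast hR.ne'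
  have hL' : frameComplexDet n L' = D * frameComplexDet n L / (R.det : ℂ) := by
    rw [eq_div_iff hRne, key]
  rw [hL']
  have e : ζ * (starRingEnd ℂ) D * (D * frameComplexDet n L / (R.det : ℂ)) =
      ((starRingEnd ℂ) D * D) * (ζ * frameComplexDet n L) / (R.det : ℂ) := by ring
  rw [e, Complex.div_intCast_re]
  have hDD : (starRingEnd ℂ) D * D = ((Complex.normSq D : ℝ) : ℂ) := by
    rw [Complex.normSq_eq_conj_mul_self]
  rw [hDD, Complex.re_ofReal_mul, h, mul_zero, zero_div]

/-- **Bundled transport** (Mikhalkin–Zharkov Prop. 4.3 in the certificate format). Let `Z` be an effective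
tropical `n`-cycle on `ℝ²ⁿ/P·ℤ²ⁿ`, `F` integral with `FJ = JF`, `det F ≠ 0`, `s > 0`, and `F·(sP) = Q'·K` with
`K` integral. Then `ℝ²ⁿ/Q'·ℤ²ⁿ` carries an effective tropical `n`-cycle `Z'` (the push-forward of `Z` along
`x ↦ F(sx)` to the coarser period lattice) with the same number of cells, frames `L'_σ` with `F L_σ = L'_σ R_σ`,
`det R_σ > 0`, Weil functional `W(Z') = sⁿ det_ℂ(F)² W(Z)` and mass `μ(Z') = sⁿ |det_ℂ(F)|² μ(Z)`.
[cite: MikhalkinZharkov2014Eigenwave, Def. 4.2 and Prop. 4.3] [cite: Zharkov2020TropicalWeil, §2 (pp. 2–4)] -/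
theorem exists_transport {P : Matrix (Fin (2 * n)) (Fin (2 * n)) ℝ} (Z : TropicalTorusCycle (2 * n) n P)
    (F : Matrix (Fin (2 * n)) (Fin (2 * n)) ℤ) (hFdet : F.det ≠ 0)
    (hFJ : F.map ((↑) : ℤ → ℝ) * weilJ n = weilJ n * F.map ((↑) : ℤ → ℝ))
    (s : ℝ) (hs : 0 < s) (K : Matrix (Fin (2 * n)) (Fin (2 * n)) ℤ) (Q' : Matrix (Fin (2 * n)) (Fin (2 * n)) ℝ)
    (hK : F.map ((↑) : ℤ → ℝ) * (s • P) = Q' * K.map ((↑) : ℤ → ℝ)) :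
    ∃ Z' : TropicalTorusCycle (2 * n) n Q',
      ∃ hc : Z'.numCells = Z.numCells,
        (∀ σ : Fin Z'.numCells, ∃ R : Matrix (Fin n) (Fin n) ℤ, 0 < R.det ∧
          F * (Z.cell (Fin.cast hc σ)).frame = (Z'.cell σ).frame * R) ∧
        weilFunctional Z' = ((s ^ n : ℝ) : ℂ) * detC⟦n, F⟧ ^ 2 * weilFunctional Z ∧
        μ⟦n, Z'⟧ = s ^ n * ‖detC⟦n, F⟧‖ ^ 2 * μ⟦n, Z⟧ := by
  classical
  obtain ⟨hF1, hF2⟩ := blocks_of_commute_weilJ F hFJ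
  -- discrete data
  obtain ⟨w', L', R, hw'pos, hsat', hfac, hRdet, hw'eq, hbal'⟩ :=
    transport_typeData (fun σ => (Z.cell σ).weight) (fun σ => (Z.cell σ).weight_pos)
      (fun σ => (Z.cell σ).frame) (fun σ => (Z.cell σ).frame_saturated) Z.facetClass Z.facetPerm
      Z.balanced F hFdet
  -- real data
  obtain ⟨hv, hT, hfe⟩ := transport_realData (fun σ => (Z.cell σ).frame) Z.facetClass Z.facetPerm Z.facetShift
    P (fun σ => (Z.cell σ).vertex) (fun σ => (Z.cell σ).edgeCoeff) Z.refFacet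
    (fun σ j a => (Z.cell σ).vertex_succ_sub j a) (fun σ => (Z.cell σ).edgeCoeff_det_pos) Z.facet_eq
    F L' R hfac hRdet s hs K Q' hK
  let Z' : TropicalTorusCycle (2 * n) n Q' :=
    { numCells := Z.numCells
      cell := fun σ =>
        { weight := w' σ
          weight_pos := hw'pos σ
          vertex := fun j => F.map ((↑) : ℤ → ℝ) *ᵥ (s • (Z.cell σ).vertex j)
          frame := L' σ
          edgeCoeff := (R σ).map ((↑) : ℤ → ℝ) * (s • (Z.cell σ).edgeCoeff)
          vertex_succ_sub := hv σ
          edgeCoeff_det_pos := hT σ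
          frame_saturated := hsat' σ }
      numFacetClasses := Z.numFacetClasses
      refFacet := fun f j => F.map ((↑) : ℤ → ℝ) *ᵥ (s • Z.refFacet f j)
      facetClass := Z.facetClass
      facetPerm := Z.facetPerm
      facetShift := fun σ i => K *ᵥ Z.facetShift σ i
      facet_eq := hfe
      balanced := hbal' }
  refine ⟨Z', rfl, fun σ => ⟨R σ, hRdet σ, hfac σ⟩, ?_, ?_⟩
  · -- Weil functional
    show (∑ σ : Fin Z.numCells, ((w' σ : ℕ) : ℂ) *
        ((((R σ).map ((↑) : ℤ → ℝ) * (s • (Z.cell σ).edgeCoeff)).det / (n.factorial : ℝ) : ℝ) : ℂ) *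
        frameComplexDet n (L' σ) ^ 2) = _
    rw [transport_weilFunctional (fun σ => (Z.cell σ).weight) w' (fun σ => (Z.cell σ).frame) L' R
      (fun σ => (Z.cell σ).edgeCoeff) F hF1 hF2 hfac hw'eq s]
    rfl
  · -- mass
    show (∑ σ : Fin Z.numCells, ((w' σ : ℕ) : ℝ) *
        (((R σ).map ((↑) : ℤ → ℝ) * (s • (Z.cell σ).edgeCoeff)).det / (n.factorial : ℝ)) *
        ‖frameComplexDet n (L' σ)‖ ^ 2) = _
    rw [Finset.mul_sum]
    refine Finset.sum_congr rfl fun σ _ => ?_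
    have key : frameComplexDet n (L' σ) * ((R σ).det : ℂ) = detC⟦n, F⟧ * frameComplexDet n (Z.cell σ).frame :=
      frameComplexDet_transport F hFJ _ _ _ (hfac σ)
    have hnormkey : ‖frameComplexDet n (L' σ)‖ * ((R σ).det : ℝ) =
        ‖detC⟦n, F⟧‖ * ‖frameComplexDet n (Z.cell σ).frame‖ := by
      have := congrArg (fun z : ℂ => ‖z‖) key
      simp only [norm_mul, Complex.norm_intCast] at this
      rwa [abs_of_pos (show (0 : ℝ) < (R σ).det by exact_mod_cast hRdet σ)] at this
    have hw'σ : ((w' σ : ℕ) : ℝ) = ((Z.cell σ).weight : ℝ) * ((R σ).det : ℝ) := by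
      have := hw'eq σ
      exact_mod_cast this
    have hdet : ((R σ).map ((↑) : ℤ → ℝ) * (s • (Z.cell σ).edgeCoeff)).det =
        ((R σ).det : ℝ) * (s ^ n * ((Z.cell σ).edgeCoeff).det) := by
      rw [Matrix.det_mul, Matrix.det_smul, Fintype.card_fin, ← Int.cast_det]
    rw [hdet, hw'σ]
    unfold TropicalCell.latticeVolume
    have e : ((Z.cell σ).weight : ℝ) * ((R σ).det : ℝ) *
        (((R σ).det : ℝ) * (s ^ n * ((Z.cell σ).edgeCoeff).det) / (n.factorial : ℝ)) *
        ‖frameComplexDet n (L' σ)‖ ^ 2 =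
        s ^ n * (‖frameComplexDet n (L' σ)‖ * ((R σ).det : ℝ)) ^ 2 *
          (((Z.cell σ).weight : ℝ) * (((Z.cell σ).edgeCoeff).det / (n.factorial : ℝ))) := by ring
    rw [e, hnormkey]
    ring

/-- The integral scalar isogeny `k = a·1 + b·J` as an integer matrix (display-only expression). -/
local notation3 (prettyPrint := false) "𝐤⟦" n ", " a ", " b "⟧" =>
  (Matrix.of fun x y : Fin (2 * n) =>
    (if x = y then (a : ℤ) else 0) +
      (if (x : ℕ) = (y : ℕ) + n then (b : ℤ) else if (y : ℕ) = (x : ℕ) + n then -(b : ℤ) else 0))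

/-- The real matrix of `k = a·1 + b·J` is `a • 1 + b • weilJ n`. [cite: Zharkov2020TropicalWeil, §2 (pp. 2–4)] -/
theorem scalarIsogeny_map (a b : ℤ) :
    (𝐤⟦n, a, b⟧).map ((↑) : ℤ → ℝ) = (a : ℝ) • (1 : Matrix (Fin (2 * n)) (Fin (2 * n)) ℝ) + (b : ℝ) • weilJ n := by
  ext x y
  simp only [Matrix.map_apply, Matrix.of_apply, Matrix.add_apply, Matrix.smul_apply, Matrix.one_apply,
    weilJ, smul_eq_mul]
  split_ifs <;> push_cast <;> ring

/-- `k = a + bJ` commutes with `J`. [folklore] -/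
theorem scalarIsogeny_comm (a b : ℤ) :
    (𝐤⟦n, a, b⟧).map ((↑) : ℤ → ℝ) * weilJ n = weilJ n * (𝐤⟦n, a, b⟧).map ((↑) : ℤ → ℝ) := by
  rw [scalarIsogeny_map, Matrix.add_mul, Matrix.mul_add, Matrix.smul_mul, Matrix.mul_smul, Matrix.one_mul,
    Matrix.mul_one, Matrix.smul_mul, Matrix.mul_smul]

/-- `det (a + bJ) ≠ 0` for `(a, b) ≠ (0, 0)`: `(a + bJ)(a − bJ) = (a² + b²)·1`. [folklore] -/
theorem scalarIsogeny_det_ne_zero (a b : ℤ) (hab : a ≠ 0 ∨ b ≠ 0) : (𝐤⟦n, a, b⟧).det ≠ 0 := by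
  have hmap : (((𝐤⟦n, a, b⟧).det : ℤ) : ℝ) = ((𝐤⟦n, a, b⟧).map ((↑) : ℤ → ℝ)).det := by
    rw [Int.cast_det]
  suffices h : ((𝐤⟦n, a, b⟧).map ((↑) : ℤ → ℝ)).det ≠ 0 by
    intro h0; apply h; rw [← hmap, h0, Int.cast_zero]
  have hprod : (𝐤⟦n, a, b⟧).map ((↑) : ℤ → ℝ) *
      ((a : ℝ) • (1 : Matrix (Fin (2 * n)) (Fin (2 * n)) ℝ) - (b : ℝ) • weilJ n) =
      ((a : ℝ) ^ 2 + (b : ℝ) ^ 2) • (1 : Matrix (Fin (2 * n)) (Fin (2 * n)) ℝ) := by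
    rw [scalarIsogeny_map, Matrix.add_mul, Matrix.mul_sub, Matrix.mul_sub, Matrix.smul_mul, Matrix.smul_mul,
      Matrix.one_mul, Matrix.one_mul, Matrix.mul_smul, Matrix.mul_smul, Matrix.smul_mul, Matrix.mul_one,
      Matrix.smul_mul, weilJ_mul_weilJ n, smul_smul, smul_smul, smul_smul, smul_neg, add_smul]
    module
  intro h0
  have := congrArg Matrix.det hprod
  rw [Matrix.det_mul, h0, zero_mul, Matrix.det_smul, Matrix.det_one, mul_one, Fintype.card_fin] at this
  have hpos : (0 : ℝ) < ((a : ℝ) ^ 2 + (b : ℝ) ^ 2) ^ (2 * n) := by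
    apply pow_pos
    rcases hab with ha | hb
    · have : (0 : ℝ) < (a : ℝ) ^ 2 := by positivity
      positivity
    · have : (0 : ℝ) < (b : ℝ) ^ 2 := by positivity
      positivity
  exact absurd this.symm hpos.ne'

/-- `det_ℂ (a + bJ) = (a + bi)ⁿ`. [folklore] -/
theorem scalarIsogeny_detC (a b : ℤ) : detC⟦n, 𝐤⟦n, a, b⟧⟧ = ((a : ℂ) + (b : ℂ) * Complex.I) ^ n := by
  have : (Matrix.of fun k j : Fin n =>
      (((𝐤⟦n, a, b⟧) ⟨(k : ℕ), by omega⟩ ⟨(j : ℕ), by omega⟩ : ℤ) : ℂ) +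
        (((𝐤⟦n, a, b⟧) ⟨(k : ℕ) + n, by omega⟩ ⟨(j : ℕ), by omega⟩ : ℤ) : ℂ) * Complex.I) =
      Matrix.diagonal fun _ : Fin n => ((a : ℂ) + (b : ℂ) * Complex.I) := by
    ext k j
    simp only [Matrix.of_apply, Matrix.diagonal_apply, Fin.mk.injEq]
    by_cases hkj : k = j
    · subst hkj
      have hn : n ≠ 0 := by have := k.isLt; omega
      simp [hn]
    · have hkj' : (k : ℕ) ≠ (j : ℕ) := fun h => hkj (Fin.ext h)
      have h1 : ¬ ((k : ℕ) = (j : ℕ) + n) := by have := k.isLt; omega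
      have h2 : ¬ ((j : ℕ) = (k : ℕ) + n) := by have := j.isLt; omega
      have h3 : ¬ ((k : ℕ) + n = (j : ℕ)) := by have := j.isLt; omega
      have h4 : ¬ ((j : ℕ) = (k : ℕ) + n + n) := by have := j.isLt; omega
      simp [hkj, hkj', h1, h2, h3, h4]
  rw [this, Matrix.det_diagonal, Finset.prod_const, Finset.card_univ, Fintype.card_fin]

/-- **Scalar isogenies are endomorphisms of every Weil torus.** For `Q` commuting with `J` and integers
`(a, b) ≠ (0, 0)`, every effective tropical `n`-cycle `Z` on `ℝ²ⁿ/Q·ℤ²ⁿ` has a push-forward `k_*Z` along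
`k = a + bJ` ON THE SAME TORUS (period lattice `Q·kℤ²ⁿ ⊆ Q·ℤ²ⁿ`), with `W(k_*Z) = (a + bi)^{2n} W(Z)` and
`μ(k_*Z) = (a² + b²)ⁿ μ(Z)`: the phase `W/μ` is multiplied by `((a+bi)/(a−bi))ⁿ`.
[cite: MikhalkinZharkov2014Eigenwave, Prop. 4.3] [cite: Zharkov2020TropicalWeil, §2 (pp. 2–4)] -/
theorem exists_endomorphism_transport {Q : Matrix (Fin (2 * n)) (Fin (2 * n)) ℝ}
    (hQJ : Q * weilJ n = weilJ n * Q) (Z : TropicalTorusCycle (2 * n) n Q) (a b : ℤ) (hab : a ≠ 0 ∨ b ≠ 0) :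
    ∃ Z' : TropicalTorusCycle (2 * n) n Q,
      ∃ hc : Z'.numCells = Z.numCells,
        (∀ σ : Fin Z'.numCells, ∃ R : Matrix (Fin n) (Fin n) ℤ, 0 < R.det ∧
          𝐤⟦n, a, b⟧ * (Z.cell (Fin.cast hc σ)).frame = (Z'.cell σ).frame * R) ∧
        weilFunctional Z' = ((a : ℂ) + (b : ℂ) * Complex.I) ^ (2 * n) * weilFunctional Z ∧
        μ⟦n, Z'⟧ = ((a : ℝ) ^ 2 + (b : ℝ) ^ 2) ^ n * μ⟦n, Z⟧ := by
  have hK : (𝐤⟦n, a, b⟧).map ((↑) : ℤ → ℝ) * ((1 : ℝ) • Q) = Q * (𝐤⟦n, a, b⟧).map ((↑) : ℤ → ℝ) := by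
    rw [one_smul, scalarIsogeny_map, Matrix.add_mul, Matrix.mul_add, Matrix.smul_mul, Matrix.mul_smul,
      Matrix.one_mul, Matrix.mul_one, Matrix.smul_mul, Matrix.mul_smul, hQJ]
  obtain ⟨Z', hc, hfr, hW, hμ⟩ := exists_transport Z (𝐤⟦n, a, b⟧) (scalarIsogeny_det_ne_zero a b hab)
    (scalarIsogeny_comm a b) 1 one_pos (𝐤⟦n, a, b⟧) Q hK
  refine ⟨Z', hc, hfr, ?_, ?_⟩
  · rw [hW, scalarIsogeny_detC, one_pow, Complex.ofReal_one, one_mul, ← pow_mul, mul_comm n 2]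
  · rw [hμ, scalarIsogeny_detC, one_pow, one_mul, norm_pow, ← pow_mul, mul_comm n 2, pow_mul]
    congr 1
    rw [Complex.sq_norm, Complex.normSq_apply]
    simp
    ring

end Summit.HodgeConjecture.HodgeConjecture.Theorems.TropicalWeilVanishing.Phases

end
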